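import Mathlib
import HarnessLib
import Summits.NavierStokesRegularity.NavierStokesRegularity.Theorems.PoloidalWindowDoorPoloidalWindowRigidityK2OfLrcSlope

/-!
# Route `PoloidalWindowDoor`, item `LrcModEntire` (stmt-NavierStokesRegularity-20428), stub `stub_twistingTH` —
# THE LOCAL ANALYTIC SLOPE OF THE STRATUM (TH) AND A BASE POINT WITH `∂_z μ ≠ 0`

Cell ns-regularity-ideate, seat ns-poloidal-K2-p3 gen 7 (lead of item 20428; file landed `--supports
stmt-NavierStokesRegularity-20428`).  First half of the REDUCTION of the registered stub `stub_twistingTH` (skeleton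
`Cruxes/LrcModEntire/Lines/twist_split.lean` v3) to the emptiness of nsreg-p7's LOCAL (TH)∩twisting PDE system
(STRUCTURE-g11: `R1 f_z = Λ w`, `R3 Δₕ f = −w_z`, `E`, twist `≠ 0`, `Λ ∉ {0,1}`, `Λ_z ≠ 0`): the stub's slope datum
`m : ℝ → ℝ → ℝ` is an ARBITRARY function with `∂₂v_b(z) = m(z.1, z.2 2) ∂_b v₂(z)` on the window `W` only; a certificate
needs an ANALYTIC slope, its jets, and a point where `∂_z` of the slope does not vanish.  This file supplies them:

* `exists_local_analytic_slope` — class regularity only: near any point `z₁ ∈ W` with `∇ₕv₂(z₁) ≠ 0` there are a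
  product ball `ball z₁ r ⊆ W` and a slope `μ` with the same identities on the ball and `uncurry μ` real-analytic on the
  `(time, height)`-shadow `ball (z₁.1, z₁.2 2) r` (the ratio `∂₂v_{b₀} / ∂_{b₀}v₂` along the vertical line through `z₁.2`,
  as in ns-poloidal-K2-p2's `…TimeHeightShearNormalForm.analyticAt_planeSlope`, but LOCAL — no all-slices hypothesis);
* `exists_height_deriv_ne_zero` — pure calculus: if moreover the item's PIN holds on the ball (the slope is a function of
  time alone on no nonempty open subset), then `∂_z μ ≠ 0` at SOME point of the ball (mean value theorem in the height);
* `exists_contDiff_eq_near` — a `C^n` modification of a locally analytic function of two variables agreeing with it near a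
  point (bump function), so that the tree's GLOBAL-regularity identities (`…TimeHeightShearPressure.timeHeightShear_pressure`,
  `…TimeHeightShearWeight.horizFDeriv_weightSource_eq_zero`, which ask `C²`/`C³` slopes on all of `ℝ`/`ℝ²`) apply to the
  local slope.

WHAT THIS IS NOT: not a claim about Navier–Stokes regularity, not the stub — bookkeeping for its reduction to a local
PDE system (bears_on LADDER-NS N0, rung N0-LocalTubeDoorPoloidal, item 20428 / crux K2 = stmt-19708).
-/

noncomputable section

-- the summit and its single sub-problem share the name (CONVENTIONS §1), as in every Theorems file
set_option linter.dupNamespace false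

namespace Summit.NavierStokesRegularity.NavierStokesRegularity.Theorems.PoloidalWindowDoorLrcModEntireTwistingTHLocalSlope

open Set Function Filter Topology Metric
open scoped RealInnerProductSpace InnerProductSpace
open Literature.Analysis Literature.Analysis.FluidPDE
open Summit.NavierStokesRegularity.NavierStokesRegularity.Theorems.PoloidalWindowDoorPoloidalWindowRigidityK2OfLrcSlope

/-! ### Pure calculus -/

/-- `|yᵢ| ≤ ‖y‖` in `ℝ³`. -/
theorem abs_apply_le_norm3 (y : EuclideanSpace ℝ (Fin 3)) (i : Fin 3) : |y i| ≤ ‖y‖ := by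
  simpa using PiLp.norm_apply_le y i

/-- The height of the vertically moved point `x + (c − x₂)e₂` is `c`. -/
theorem vmove_apply_two (x : EuclideanSpace ℝ (Fin 3)) (c : ℝ) :
    (x + (c - x 2) • EuclideanSpace.single 2 (1 : ℝ) : EuclideanSpace ℝ (Fin 3)) 2 = c := by
  simp

/-- The vertically moved point `x + (c − x₂)e₂` is at distance `|c − x₂|` from `x`. -/
theorem dist_vmove (x : EuclideanSpace ℝ (Fin 3)) (c : ℝ) :
    dist (x + (c - x 2) • EuclideanSpace.single 2 (1 : ℝ)) x = |c - x 2| := by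
  rw [dist_eq_norm, add_sub_cancel_left, norm_smul, Real.norm_eq_abs]
  simp

/-- In the product metric, moving the space point of `(s, x)` vertically to height `c` lands at distance
`dist (s, c) (z.1, z.2 2)` from `z = (z.1, z.2)` when `x = z.2`. -/
theorem dist_vmove_prod (z : ℝ × EuclideanSpace ℝ (Fin 3)) (q : ℝ × ℝ) :
    dist ((q.1, z.2 + (q.2 - z.2 2) • EuclideanSpace.single 2 (1 : ℝ)) : ℝ × EuclideanSpace ℝ (Fin 3)) z =
      dist q (z.1, z.2 2) := by
  rw [Prod.dist_eq, Prod.dist_eq, dist_vmove]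
  rfl

/-- The `(time, height)`-shadow `(p.1, p.2 2)` of a point of the product ball `ball z r` lies in the shadow ball
`ball (z.1, z.2 2) r`. -/
theorem shadow_mem_ball {z p : ℝ × EuclideanSpace ℝ (Fin 3)} {r : ℝ} (hp : p ∈ ball z r) :
    ((p.1, p.2 2) : ℝ × ℝ) ∈ ball (z.1, z.2 2) r := by
  rw [mem_ball, Prod.dist_eq] at hp ⊢
  refine max_lt (lt_of_le_of_lt (le_max_left _ _) hp) (lt_of_le_of_lt ?_ (lt_of_le_of_lt (le_max_right _ _) hp))
  show dist (p.2 2) (z.2 2) ≤ dist p.2 z.2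
  rw [Real.dist_eq, dist_eq_norm]
  have h := abs_apply_le_norm3 (p.2 - z.2) 2
  simpa using h

/-- **A `C^n` modification of a locally analytic function of two variables.**  If `G : ℝ × ℝ → ℝ` is real-analytic at
every point of an open `O ∋ q₀`, there are `Ĝ : ℝ × ℝ → ℝ` of class `C^n` on all of `ℝ²` and `ρ > 0` with `Ĝ = G` on
`ball q₀ ρ ⊆ O` (multiply by a bump function supported in `O` and equal to `1` near `q₀`). -/
theorem exists_contDiff_eq_near {G : ℝ × ℝ → ℝ} {O : Set (ℝ × ℝ)} {q₀ : ℝ × ℝ} (hO : IsOpen O) (hq₀ : q₀ ∈ O)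
    (hG : ∀ q ∈ O, AnalyticAt ℝ G q) (n : ℕ∞) :
    ∃ Ĝ : ℝ × ℝ → ℝ, ∃ ρ > 0, ContDiff ℝ n Ĝ ∧ ball q₀ ρ ⊆ O ∧ ∀ q ∈ ball q₀ ρ, Ĝ q = G q := by
  obtain ⟨d, hd, hdO⟩ := Metric.isOpen_iff.1 hO q₀ hq₀
  -- a bump function equal to one on `closedBall q₀ (d/4)` and supported in `ball q₀ (d/2)`
  let χ : ContDiffBump q₀ := ⟨d / 4, d / 2, by positivity, by linarith⟩
  refine ⟨fun q => χ q * G q, d / 4, by positivity, ?_, ?_, ?_⟩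
  · refine contDiff_iff_contDiffAt.2 fun q => ?_
    by_cases hq : q ∈ O
    · exact χ.contDiff.contDiffAt.mul (hG q hq).contDiffAt
    · -- outside `O` the bump vanishes near `q`
      have hfar : d ≤ dist q q₀ := by
        by_contra h
        exact hq (hdO (mem_ball.2 (lt_of_not_ge h)))
      have hzero : (fun q' => χ q' * G q') =ᶠ[𝓝 q] fun _ => 0 := by
        have hopen : IsOpen {q' : ℝ × ℝ | d / 2 < dist q' q₀} :=
          isOpen_lt continuous_const (continuous_id.dist continuous_const)
        have hmem : q ∈ {q' : ℝ × ℝ | d / 2 < dist q' q₀} := by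
          show d / 2 < dist q q₀
          linarith
        filter_upwards [hopen.mem_nhds hmem] with q' hq'
        have h0 : χ q' = 0 := χ.zero_of_le_dist (le_of_lt hq')
        rw [h0, zero_mul]
      exact (contDiffAt_const.congr_of_eventuallyEq hzero)
  · intro q hq
    exact hdO (ball_subset_ball (by linarith) hq)
  · intro q hq
    have h1 : χ q = 1 := χ.one_of_mem_closedBall (mem_closedBall.2 (le_of_lt (mem_ball.1 hq)))
    show χ q * G q = G q
    rw [h1, one_mul]

/-- **Mean value theorem in the height, contrapositive form used by the PIN.**  Let `μ : ℝ → ℝ → ℝ` have height slices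
differentiable on the shadow ball `ball (z.1, z.2 2) r` and let the proportional-shear identities
`∂₂v_b(p) = μ(p.1, p.2 2) ∂_b v₂(p)` (`b = 0,1`) hold on the product ball `ball z r`.  If the slope is a function of TIME
ALONE on no nonempty open subset of the ball (the item's pin), then `∂_z μ(p.1, p.2 2) ≠ 0` at some point `p` of the ball. -/
theorem exists_height_deriv_ne_zero {v : ℝ → EuclideanSpace ℝ (Fin 3) → EuclideanSpace ℝ (Fin 3)}
    {z : ℝ × EuclideanSpace ℝ (Fin 3)} {r : ℝ} (hr : 0 < r) {μ : ℝ → ℝ → ℝ}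
    (hμd : ∀ q ∈ ball ((z.1, z.2 2) : ℝ × ℝ) r, DifferentiableAt ℝ (μ q.1) q.2)
    (hid : ∀ p ∈ ball z r, ∀ b : Fin 3, b ≠ 2 →
      fderiv ℝ (v p.1) p.2 (EuclideanSpace.single 2 1) b =
        μ p.1 (p.2 2) * fderiv ℝ (v p.1) p.2 (EuclideanSpace.single b 1) 2)
    (hpin : ∀ n : ℝ → ℝ, ∀ W₁ : Set (ℝ × EuclideanSpace ℝ (Fin 3)), W₁ ⊆ ball z r → IsOpen W₁ → W₁.Nonempty →
      ∃ p ∈ W₁, ∃ b : Fin 3, b ≠ 2 ∧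
        fderiv ℝ (v p.1) p.2 (EuclideanSpace.single 2 1) b ≠
          n p.1 * fderiv ℝ (v p.1) p.2 (EuclideanSpace.single b 1) 2) :
    ∃ p ∈ ball z r, deriv (μ p.1) (p.2 2) ≠ 0 := by
  by_contra h
  push Not at h
  -- the candidate time-only slope: the value on the axis height `z.2 2`
  set n : ℝ → ℝ := fun s => μ s (z.2 2) with hn
  -- on the ball, `μ(p.1, ·)` is constant on the height interval `(z.2 2 − r, z.2 2 + r)`
  have hconst : ∀ p ∈ ball z r, μ p.1 (p.2 2) = n p.1 := by
    intro p hp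
    have hp1 : dist p.1 z.1 < r := lt_of_le_of_lt (le_max_left _ _) (by rwa [mem_ball, Prod.dist_eq] at hp)
    have hJ : ∀ c ∈ Ioo (z.2 2 - r) (z.2 2 + r),
        ((p.1, z.2 + (c - z.2 2) • EuclideanSpace.single 2 (1 : ℝ)) : ℝ × EuclideanSpace ℝ (Fin 3)) ∈ ball z r := by
      intro c hc
      rw [mem_ball, Prod.dist_eq, dist_vmove]
      refine max_lt hp1 ?_
      show |c - z.2 2| < r
      rw [abs_lt]; constructor <;> linarith [hc.1, hc.2]
    have hderiv : ∀ c ∈ Ioo (z.2 2 - r) (z.2 2 + r), deriv (μ p.1) c = 0 := by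
      intro c hc
      have h' := h _ (hJ c hc)
      have e : ((z.2 + (c - z.2 2) • EuclideanSpace.single 2 (1 : ℝ) : EuclideanSpace ℝ (Fin 3)) 2) = c :=
        vmove_apply_two z.2 c
      simp only [e] at h'
      exact h'
    have hdiff : DifferentiableOn ℝ (μ p.1) (Ioo (z.2 2 - r) (z.2 2 + r)) := by
      intro c hc
      refine (hμd (p.1, c) ?_).differentiableWithinAt
      rw [mem_ball, Prod.dist_eq]
      refine max_lt hp1 ?_
      show |c - z.2 2| < r
      rw [abs_lt]; constructor <;> linarith [hc.1, hc.2]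
    have hp2 : p.2 2 ∈ Ioo (z.2 2 - r) (z.2 2 + r) := by
      have h2 : |p.2 2 - z.2 2| < r := by
        have hle : |p.2 2 - z.2 2| ≤ ‖p.2 - z.2‖ := by
          have := abs_apply_le_norm3 (p.2 - z.2) 2; simpa using this
        have hlt : ‖p.2 - z.2‖ < r := by
          have := lt_of_le_of_lt (le_max_right _ _) (by rwa [mem_ball, Prod.dist_eq] at hp)
          rwa [dist_eq_norm] at this
        exact lt_of_le_of_lt hle hlt
      rw [abs_lt] at h2
      exact ⟨by linarith [h2.1], by linarith [h2.2]⟩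
    have hz2 : z.2 2 ∈ Ioo (z.2 2 - r) (z.2 2 + r) := ⟨by linarith, by linarith⟩
    exact IsOpen.is_const_of_deriv_eq_zero isOpen_Ioo (convex_Ioo _ _).isPreconnected hdiff
      (fun c hc => hderiv c hc) hp2 hz2
  -- contradiction with the pin on the ball itself
  obtain ⟨p, hp, b, hb, hne⟩ := hpin n (ball z r) Subset.rfl isOpen_ball ⟨z, mem_ball_self hr⟩
  exact hne (by rw [hid p hp b hb, hconst p hp])

/-! ### Class form: the local analytic slope -/

variable {C : ℝ} {v : ℝ → EuclideanSpace ℝ (Fin 3) → EuclideanSpace ℝ (Fin 3)}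

/-- **THE LOCAL ANALYTIC SLOPE OF (TH).**  Let `v` be a profile of the route's Type-I class (rate, continuity, Oseen-mild),
`W` an open subset of the backward slab on which the proportional-shear identities hold with a slope `m(t, y₂)` depending on
time and height only, and `z₁ ∈ W` a point with `∇ₕ v₂(z₁) ≠ 0`.  Then on some product ball `ball z₁ r ⊆ W` the SAME
identities hold with a slope `μ` whose uncurried form is real-analytic on the shadow ball `ball (z₁.1, z₁.2 2) r`
(`μ(s,c) = ∂₂v_{b₀}(s, y_c) / ∂_{b₀}v₂(s, y_c)` along the vertical line `y_c = z₁.2 + (c − (z₁.2)₂)e₂`). -/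
theorem exists_local_analytic_slope (hrate : HasTypeITimeDecay C v)
    (hcont : ContinuousOn (uncurry v) (Iio (0 : ℝ) ×ˢ univ))
    (hmild : ∀ s t : ℝ, s < t → t < 0 → ∀ x,
      v t x = UnboundedOperators.heatExtension (v s) (t - s) x - oseenDuhamel 1 s v v t x)
    {W : Set (ℝ × EuclideanSpace ℝ (Fin 3))} (hW : IsOpen W) (hWs : W ⊆ Iio (0 : ℝ) ×ˢ univ)
    {z₁ : ℝ × EuclideanSpace ℝ (Fin 3)} (hz₁ : z₁ ∈ W)
    (hnd₁ : fderiv ℝ (v z₁.1) z₁.2 (EuclideanSpace.single 0 1) 2 ≠ 0 ∨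
      fderiv ℝ (v z₁.1) z₁.2 (EuclideanSpace.single 1 1) 2 ≠ 0)
    {m : ℝ → ℝ → ℝ}
    (hTH : ∀ z ∈ W, ∀ b : Fin 3, b ≠ 2 →
      fderiv ℝ (v z.1) z.2 (EuclideanSpace.single 2 1) b =
        m z.1 (z.2 2) * fderiv ℝ (v z.1) z.2 (EuclideanSpace.single b 1) 2) :
    ∃ r > 0, ball z₁ r ⊆ W ∧ ∃ μ : ℝ → ℝ → ℝ,
      (∀ p ∈ ball z₁ r, ∀ b : Fin 3, b ≠ 2 →
        fderiv ℝ (v p.1) p.2 (EuclideanSpace.single 2 1) b =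
          μ p.1 (p.2 2) * fderiv ℝ (v p.1) p.2 (EuclideanSpace.single b 1) 2) ∧
      (∀ q ∈ ball ((z₁.1, z₁.2 2) : ℝ × ℝ) r, AnalyticAt ℝ (uncurry μ) q) := by
  -- a horizontal index with `∂_{b₀} v₂(z₁) ≠ 0`
  obtain ⟨b₀, hb₀, hne⟩ : ∃ b₀ : Fin 3, b₀ ≠ 2 ∧ fderiv ℝ (v z₁.1) z₁.2 (EuclideanSpace.single b₀ 1) 2 ≠ 0 := by
    rcases hnd₁ with h | h
    · exact ⟨0, by decide, h⟩
    · exact ⟨1, by decide, h⟩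
  -- the vertical-line family `ι (s,c) = (s, z₁.2 + (c − (z₁.2)₂)e₂)`
  set ι : ℝ × ℝ → ℝ × EuclideanSpace ℝ (Fin 3) :=
    fun q => (q.1, z₁.2 + (q.2 - z₁.2 2) • EuclideanSpace.single 2 (1 : ℝ)) with hι
  have hιa : ∀ q, AnalyticAt ℝ ι q := fun q =>
    analyticAt_fst.prod (analyticAt_const.add ((analyticAt_snd.sub analyticAt_const).smul analyticAt_const))
  have hι2 : ∀ q, (ι q).2 2 = q.2 := fun q => by simp [hι]
  have hιd : ∀ q, dist (ι q) z₁ = dist q (z₁.1, z₁.2 2) := fun q => dist_vmove_prod z₁ q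
  -- the denominator is non-zero near `z₁` (joint continuity on the slab), inside `W`
  have hslab : IsOpen (Iio (0 : ℝ) ×ˢ (univ : Set (EuclideanSpace ℝ (Fin 3)))) := isOpen_Iio.prod isOpen_univ
  have hO : IsOpen ((Iio (0 : ℝ) ×ˢ univ) ∩
      (fun z : ℝ × EuclideanSpace ℝ (Fin 3) => fderiv ℝ (v z.1) z.2 (EuclideanSpace.single b₀ 1) 2) ⁻¹' {0}ᶜ) :=
    (continuousOn_fderiv_entry hrate hcont hmild b₀ 2).isOpen_inter_preimage hslab isOpen_compl_singleton
  have hz₁O : z₁ ∈ W ∩ ((Iio (0 : ℝ) ×ˢ univ) ∩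
      (fun z : ℝ × EuclideanSpace ℝ (Fin 3) => fderiv ℝ (v z.1) z.2 (EuclideanSpace.single b₀ 1) 2) ⁻¹' {0}ᶜ) :=
    ⟨hz₁, hWs hz₁, hne⟩
  obtain ⟨r, hr, hrW⟩ := Metric.isOpen_iff.1 (hW.inter hO) z₁ hz₁O
  have hballW : ball z₁ r ⊆ W := fun p hp => (hrW hp).1
  have hballne : ∀ p ∈ ball z₁ r, fderiv ℝ (v p.1) p.2 (EuclideanSpace.single b₀ 1) 2 ≠ 0 :=
    fun p hp => (hrW hp).2.2
  -- the slope along the vertical line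
  set μ : ℝ → ℝ → ℝ := fun s c =>
    fderiv ℝ (v (ι (s, c)).1) (ι (s, c)).2 (EuclideanSpace.single 2 1) b₀ /
      fderiv ℝ (v (ι (s, c)).1) (ι (s, c)).2 (EuclideanSpace.single b₀ 1) 2 with hμ
  refine ⟨r, hr, hballW, μ, ?_, ?_⟩
  · -- the identities hold with `μ`: `m(p.1, p.2 2)` is the ratio at the axis point of the same height
    intro p hp b hb
    have hq : ι (p.1, p.2 2) ∈ ball z₁ r := by
      rw [mem_ball, hιd]
      exact mem_ball.1 (shadow_mem_ball hp)
    have hax := hTH _ (hballW hq) b₀ hb₀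
    rw [hι2] at hax
    have hm : m p.1 (p.2 2) = μ p.1 (p.2 2) := by
      rw [hμ]
      exact eq_div_of_mul_eq (hballne _ hq) hax.symm
    rw [hTH p (hballW hp) b hb, hm]
  · -- analyticity of the ratio on the shadow ball
    intro q hq
    have hq' : ι q ∈ ball z₁ r := by rw [mem_ball, hιd]; exact mem_ball.1 hq
    have hmem : ι q ∈ Iio (0 : ℝ) ×ˢ (univ : Set (EuclideanSpace ℝ (Fin 3))) := hWs (hballW hq')
    have hN : AnalyticAt ℝ (fun q' : ℝ × ℝ => fderiv ℝ (v (ι q').1) (ι q').2 (EuclideanSpace.single 2 1) b₀) q :=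
      (analyticOnNhd_uncurry_fderiv_entry hrate hcont hmild 2 b₀ _ hmem).comp (hιa q)
    have hD : AnalyticAt ℝ (fun q' : ℝ × ℝ => fderiv ℝ (v (ι q').1) (ι q').2 (EuclideanSpace.single b₀ 1) 2) q :=
      (analyticOnNhd_uncurry_fderiv_entry hrate hcont hmild b₀ 2 _ hmem).comp (hιa q)
    have heq : uncurry μ = fun q' : ℝ × ℝ =>
        fderiv ℝ (v (ι q').1) (ι q').2 (EuclideanSpace.single 2 1) b₀ /
          fderiv ℝ (v (ι q').1) (ι q').2 (EuclideanSpace.single b₀ 1) 2 := by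
      funext q'; rcases q' with ⟨s, c⟩; rfl
    rw [heq]
    exact hN.div hD (hballne _ hq')

end Summit.NavierStokesRegularity.NavierStokesRegularity.Theorems.PoloidalWindowDoorLrcModEntireTwistingTHLocalSlope

end
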